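import Literature.NumberTheory.LFunctions.WeilBochnerRepresentation
import HarnessLib

/-!
# The Bochner–Kreĭn measure represents the full sesquilinear Weil form on the window

Topic `Literature/NumberTheory/LFunctions` (normalisation of `WeilExplicit.lean`).  Companion of
`WeilBochnerRepresentation.lean`: there, Weil positivity on `[-b, b]` produces a positive measure `μ`
with `W(g ⋆ g̃) = ∫ ‖ĝ(½+it)‖² dμ` for every test `g` supported in `[-b, b]`.  Here, by POLARISATION,
any such `μ` represents the whole hermitian form:

  `W(g ⋆ h̃) = ∫ ĝ(½+it) · conj ĥ(½+it) dμ(t)`   for all tests `g, h` supported in `[-b, b]`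

(`weilFunctional_weilConv_weilReflect_eq_integral`), i.e. `μ` is a GRAM MEASURE for the window:
the Weil form on `C_c^∞[-b, b]` is the `L²(μ)` inner product of the transforms on the critical line
(`exists_gram_measure_of_weilPositivityOn`).  Ingredients: `weilQuadratic_add` (tree:
`Q(g+h) = Q(g) + Q(h) + W(g ⋆ h̃) + W(h ⋆ g̃)`), the same with `h ↦ i·h`, and
`‖a + b‖² = ‖a‖² + ‖b‖² + 2 Re(a b̄)`.  Everything here is PROVED; no definitions.

## References
* M. G. Kreĭn (1940) [cite: Krein1940]; E. Bombieri, *Remarks on Weil's quadratic functional …* (2000),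
  §3 (the hermitian form attached to `T`).
-/

noncomputable section

open Complex Filter Set MeasureTheory
open scoped Real Topology ComplexConjugate

namespace Literature.NumberTheory.LFunctions

namespace WeilBochner

variable {b : ℝ} {g h : ℝ → ℂ} {μ : Measure ℝ}

/-- `i·h` is a test supported where `h` is. [folklore] -/
private theorem isWeilTest_I_mul (hh : IsWeilTest h) : IsWeilTest (fun t ↦ I * h t) := hh.const_mul I

/-- `supp (i·h) ⊆ supp h`. [folklore] -/
private theorem tsupport_I_mul_subset (h : ℝ → ℂ) : tsupport (fun t ↦ I * h t) ⊆ tsupport h :=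
  tsupport_mul_subset_right

/-- `‖a + b‖² = ‖a‖² + ‖b‖² + 2 Re(a conj b)`. [folklore] -/
private theorem norm_add_sq_eq (a c : ℂ) :
    ‖a + c‖ ^ 2 = ‖a‖ ^ 2 + ‖c‖ ^ 2 + 2 * (a * conj c).re := by
  rw [← Complex.normSq_eq_norm_sq, ← Complex.normSq_eq_norm_sq, ← Complex.normSq_eq_norm_sq,
    Complex.normSq_add]

/-- `Re(a · conj(i c)) = Im(a conj c)`. [folklore] -/
private theorem re_mul_conj_I_mul (a c : ℂ) : (a * conj (I * c)).re = (a * conj c).im := by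
  simp [map_mul, Complex.conj_I]
  ring

/-- **Polarisation: a representing measure for the squares represents the sesquilinear form.**
Let `μ` be a measure on `ℝ` such that for every test `f` supported in `[-b, b]` the density
`‖f̂(½+it)‖²` is `μ`-integrable and `W(f ⋆ f̃) = ∫ ‖f̂(½+it)‖² dμ` (e.g. the measure of
`exists_measure_of_weilPositivityOn`).  Then for all tests `g, h` supported in `[-b, b]` the product
`ĝ(½+it) conj ĥ(½+it)` is `μ`-integrable and

  `W(g ⋆ h̃) = ∫ ĝ(½+it) conj ĥ(½+it) dμ(t)`.

[cite: Krein1940] -/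
theorem weilFunctional_weilConv_weilReflect_eq_integral
    (hμ : ∀ f : ℝ → ℂ, IsWeilTest f → tsupport f ⊆ Icc (-b) b →
      Integrable (fun t : ℝ ↦ ‖weilMellin f (1 / 2 + t * I)‖ ^ 2) μ ∧
        weilQuadratic f = ((∫ t, ‖weilMellin f (1 / 2 + t * I)‖ ^ 2 ∂μ : ℝ) : ℂ))
    (hg : IsWeilTest g) (hgs : tsupport g ⊆ Icc (-b) b)
    (hh : IsWeilTest h) (hhs : tsupport h ⊆ Icc (-b) b) :
    Integrable (fun t : ℝ ↦ weilMellin g (1 / 2 + t * I) * conj (weilMellin h (1 / 2 + t * I))) μ ∧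
      weilFunctional (weilConv g (weilReflect h)) =
        ∫ t, weilMellin g (1 / 2 + t * I) * conj (weilMellin h (1 / 2 + t * I)) ∂μ := by
  -- names
  set G : ℝ → ℂ := fun t ↦ weilMellin g (1 / 2 + t * I) with hG
  set H : ℝ → ℂ := fun t ↦ weilMellin h (1 / 2 + t * I) with hH
  set z : ℝ → ℂ := fun t ↦ G t * conj (H t) with hz
  have h1 : Continuous fun t : ℝ ↦ (1 / 2 : ℂ) + t * I := by fun_prop
  have hGc : Continuous G := (continuous_weilMellin hg.1.continuous hg.2).comp h1
  have hHc : Continuous H := (continuous_weilMellin hh.1.continuous hh.2).comp h1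
  have hzc : Continuous z := hGc.mul (Complex.continuous_conj.comp hHc)
  -- the four squares
  obtain ⟨hGi, hQg⟩ := hμ g hg hgs
  obtain ⟨hHi, hQh⟩ := hμ h hh hhs
  have hIh : IsWeilTest (fun t ↦ I * h t) := isWeilTest_I_mul hh
  have hIhs : tsupport (fun t ↦ I * h t) ⊆ Icc (-b) b := (tsupport_I_mul_subset h).trans hhs
  have hgh : IsWeilTest (g + h) := hg.add hh
  have hghs : tsupport (g + h) ⊆ Icc (-b) b := (tsupport_add g h).trans (union_subset hgs hhs)
  have hgIh : IsWeilTest (g + fun t ↦ I * h t) := hg.add hIh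
  have hgIhs : tsupport (g + fun t ↦ I * h t) ⊆ Icc (-b) b :=
    (tsupport_add _ _).trans (union_subset hgs hIhs)
  obtain ⟨-, hQgh⟩ := hμ _ hgh hghs
  obtain ⟨-, hQgIh⟩ := hμ _ hgIh hgIhs
  -- transforms of the sums
  have hMgh : ∀ t : ℝ, weilMellin (g + h) (1 / 2 + t * I) = G t + H t := fun t ↦
    weilMellin_add hg.1.continuous hg.2 hh.1.continuous hh.2 _
  have hMIh : ∀ t : ℝ, weilMellin (fun x ↦ I * h x) (1 / 2 + t * I) = I * H t := fun t ↦
    weilMellin_const_mul I h _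
  have hMgIh : ∀ t : ℝ, weilMellin (g + fun x ↦ I * h x) (1 / 2 + t * I) = G t + I * H t := fun t ↦ by
    rw [weilMellin_add hg.1.continuous hg.2 hIh.1.continuous hIh.2, hMIh]
  -- integrability of the cross term: `‖G conj H‖ ≤ (‖G‖² + ‖H‖²)/2`
  have hzi : Integrable z μ := by
    refine Integrable.mono' ((hGi.add hHi).div_const 2) hzc.aestronglyMeasurable
      (ae_of_all _ fun t ↦ ?_)
    rw [hz]
    simp only [norm_mul, Complex.norm_conj, Pi.add_apply]
    nlinarith [sq_nonneg (‖G t‖ - ‖H t‖), norm_nonneg (G t), norm_nonneg (H t)]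
  have hzre : Integrable (fun t ↦ (z t).re) μ := hzi.re
  have hzim : Integrable (fun t ↦ (z t).im) μ := hzi.im
  have hGi' : Integrable (fun t ↦ ‖G t‖ ^ 2) μ := hGi
  have hHi' : Integrable (fun t ↦ ‖H t‖ ^ 2) μ := hHi
  have hGH : Integrable (fun t ↦ ‖G t‖ ^ 2 + ‖H t‖ ^ 2) μ := hGi'.add hHi'
  have hB : ∫ t, ‖G t‖ ^ 2 + ‖H t‖ ^ 2 ∂μ = (∫ t, ‖G t‖ ^ 2 ∂μ) + ∫ t, ‖H t‖ ^ 2 ∂μ :=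
    integral_add hGi' hHi'
  set B₁ := weilFunctional (weilConv g (weilReflect h)) with hB₁
  set B₂ := weilFunctional (weilConv h (weilReflect g)) with hB₂
  -- (1) `W(g ⋆ h̃) + W(h ⋆ g̃) = 2 ∫ Re z`
  have hs : B₁ + B₂ = 2 * ((∫ t, (z t).re ∂μ : ℝ) : ℂ) := by
    have hadd := weilQuadratic_add hg hh
    rw [hQgh, hQg, hQh] at hadd
    have hA : ∫ t, (‖G t‖ ^ 2 + ‖H t‖ ^ 2) + 2 * (z t).re ∂μ =
        (∫ t, ‖G t‖ ^ 2 + ‖H t‖ ^ 2 ∂μ) + ∫ t, 2 * (z t).re ∂μ :=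
      integral_add hGH (hzre.const_mul 2)
    have hC : ∫ t, 2 * (z t).re ∂μ = 2 * ∫ t, (z t).re ∂μ := integral_const_mul 2 _
    have hI : ∫ t, ‖weilMellin (g + h) (1 / 2 + t * I)‖ ^ 2 ∂μ =
        (∫ t, ‖G t‖ ^ 2 ∂μ) + (∫ t, ‖H t‖ ^ 2 ∂μ) + 2 * ∫ t, (z t).re ∂μ := by
      have e : (fun t : ℝ ↦ ‖weilMellin (g + h) (1 / 2 + t * I)‖ ^ 2) =
          fun t ↦ (‖G t‖ ^ 2 + ‖H t‖ ^ 2) + 2 * (z t).re := by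
        funext t; rw [hMgh, norm_add_sq_eq]
      rw [e, hA, hB, hC]
    rw [hI] at hadd
    push_cast at hadd
    linear_combination -hadd
  -- (2) `-i W(g ⋆ h̃) + i W(h ⋆ g̃) = 2 ∫ Im z`
  have hd : -I * B₁ + I * B₂ = 2 * ((∫ t, (z t).im ∂μ : ℝ) : ℂ) := by
    have hadd := weilQuadratic_add hg hIh
    -- `Q(i h) = ∫ ‖H‖²`, the cross terms
    have hQIh : weilQuadratic (fun t ↦ I * h t) = ((∫ t, ‖H t‖ ^ 2 ∂μ : ℝ) : ℂ) := by
      rw [(hμ _ hIh hIhs).2]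
      congr 1
      refine integral_congr_ae (ae_of_all _ fun t ↦ ?_)
      simp only [hMIh, norm_mul, Complex.norm_I, one_mul]
    have hc1 : weilFunctional (weilConv g (weilReflect fun t ↦ I * h t)) = -I * B₁ := by
      rw [hB₁, weilReflect_const_mul, weilConv_const_mul_right, weilFunctional_const_mul, Complex.conj_I]
    have hc2 : weilFunctional (weilConv (fun t ↦ I * h t) (weilReflect g)) = I * B₂ := by
      rw [hB₂, weilConv_const_mul_left, weilFunctional_const_mul]
    rw [hQgIh, hQg, hQIh, hc1, hc2] at hadd
    have hA : ∫ t, (‖G t‖ ^ 2 + ‖H t‖ ^ 2) + 2 * (z t).im ∂μ =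
        (∫ t, ‖G t‖ ^ 2 + ‖H t‖ ^ 2 ∂μ) + ∫ t, 2 * (z t).im ∂μ :=
      integral_add hGH (hzim.const_mul 2)
    have hC : ∫ t, 2 * (z t).im ∂μ = 2 * ∫ t, (z t).im ∂μ := integral_const_mul 2 _
    have hI : ∫ t, ‖weilMellin (g + fun x ↦ I * h x) (1 / 2 + t * I)‖ ^ 2 ∂μ =
        (∫ t, ‖G t‖ ^ 2 ∂μ) + (∫ t, ‖H t‖ ^ 2 ∂μ) + 2 * ∫ t, (z t).im ∂μ := by
      have e : (fun t : ℝ ↦ ‖weilMellin (g + fun x ↦ I * h x) (1 / 2 + t * I)‖ ^ 2) =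
          fun t ↦ (‖G t‖ ^ 2 + ‖H t‖ ^ 2) + 2 * (z t).im := by
        funext t
        rw [hMgIh, norm_add_sq_eq, norm_mul, Complex.norm_I, one_mul, re_mul_conj_I_mul]
      rw [e, hA, hB, hC]
    rw [hI] at hadd
    push_cast at hadd
    linear_combination -hadd
  -- assemble: `W(g ⋆ h̃) = ∫ Re z + i ∫ Im z = ∫ z`
  refine ⟨hzi, ?_⟩
  have hsplit : ∫ t, z t ∂μ = ((∫ t, (z t).re ∂μ : ℝ) : ℂ) + ((∫ t, (z t).im ∂μ : ℝ) : ℂ) * I := by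
    have e : ∀ t, z t = ((z t).re : ℂ) + ((z t).im : ℂ) * I := fun t ↦ (Complex.re_add_im (z t)).symm
    have h3 : Integrable (fun t ↦ ((z t).re : ℂ)) μ := hzre.ofReal
    have h4 : Integrable (fun t ↦ ((z t).im : ℂ) * I) μ := hzim.ofReal.mul_const I
    calc ∫ t, z t ∂μ = ∫ t, ((z t).re : ℂ) + ((z t).im : ℂ) * I ∂μ := integral_congr_ae (ae_of_all _ e)
      _ = (∫ t, ((z t).re : ℂ) ∂μ) + ∫ t, ((z t).im : ℂ) * I ∂μ := integral_add h3 h4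
      _ = ((∫ t, (z t).re ∂μ : ℝ) : ℂ) + ((∫ t, (z t).im ∂μ : ℝ) : ℂ) * I := by
          rw [integral_mul_const, integral_complex_ofReal, integral_complex_ofReal]
  show B₁ = _
  rw [hsplit]
  linear_combination (1 / 2 : ℂ) * hs + (I / 2 : ℂ) * hd + ((B₁ - B₂) / 2) * Complex.I_sq

/-- **Gram-measure form of a rung.**  If `WeilPositivityOn b` (`b > 0`) then there is a positive regular
measure `μ` on `ℝ` such that for all tests `g, h` supported in `[-b, b]`:
`W(g ⋆ h̃) = ∫ ĝ(½+it) conj ĥ(½+it) dμ(t)` (integrand in `L¹(μ)`) — the Weil form on the window is the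
`L²(μ)` inner product of the transforms on the critical line. [cite: Krein1940] -/
theorem exists_gram_measure_of_weilPositivityOn (hb : 0 < b) (hpos : WeilPositivityOn b) :
    ∃ μ : Measure ℝ, μ.Regular ∧ ∀ g h : ℝ → ℂ, IsWeilTest g → tsupport g ⊆ Icc (-b) b →
      IsWeilTest h → tsupport h ⊆ Icc (-b) b →
        Integrable (fun t : ℝ ↦ weilMellin g (1 / 2 + t * I) * conj (weilMellin h (1 / 2 + t * I))) μ ∧
          weilFunctional (weilConv g (weilReflect h)) =
            ∫ t, weilMellin g (1 / 2 + t * I) * conj (weilMellin h (1 / 2 + t * I)) ∂μ := by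
  obtain ⟨μ, hreg, hμ⟩ := exists_measure_of_weilPositivityOn hb hpos
  exact ⟨μ, hreg, fun g h hg hgs hh hhs ↦
    weilFunctional_weilConv_weilReflect_eq_integral hμ hg hgs hh hhs⟩

end WeilBochner

end Literature.NumberTheory.LFunctions

end
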